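import Literature.AlgebraicGeometry.HodgeTheory.VHSDataUnipotentMonodromyFiniteEtaleCover
import Literature.AlgebraicGeometry.Motives.FamiliesVHSTensorMonodromy
import HarnessLib

/-!
# The finite étale cover of level `3` for `𝒱` makes the local monodromy of ALL the tensor constructions `𝒱^{⊗m}`, `T^{a,b}𝒱`, `𝒱^∨`, `𝒱(j)`
# (and, on the common cover, of `𝒱₁ ⊗ 𝒱₂`, `Hom(𝒱₁, 𝒱₂)`) unipotent wherever it is quasi-unipotent (Cattani–Deligne–Kaplan, «Proof of 1.5 ⟹ 1.1»)

Topic `Literature/AlgebraicGeometry/HodgeTheory` (namespace `Literature.AlgebraicGeometry.Motives.VHSData`), lane `lit-hodgefound` (seat `p08`, row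
g57-#16).  THEOREMS ONLY (no definition, no named fact, no instance; D-0026 net debt `0`).  Junction of
`HodgeTheory/VHSDataUnipotentMonodromyFiniteEtaleCover` (the finite étale cover attached to the level-`3` subgroup, granted Riemann's existence theorem in
the form of the tree's named fact `FundamentalGroup.riemannExistence_finiteCovering`, SGA1 XII 5.1), `Motives/FamiliesVHSLevelStructureUnipotentMonodromy`
§4–§5 (the level structure pulls back and is base-point free) and `Motives/FamiliesVHSTensorMonodromy` §5 (CDK's sentence for the tensor constructions from
the level structure and quasi-unipotence of `𝒱` ALONE).

PRINTED SOURCE, VERBATIM.  E. Cattani, P. Deligne, A. Kaplan, *On the locus of Hodge classes*, J. Amer. Math. Soc. 8 (1995), «Proof of 1.5 ⟹ 1.1»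
(p. 485; held text `paper:arxiv-alg-geom_9402009` p0002): «To prove 1.1 one is free to replace `S` of 1.1 by a finite etale covering `S' → S`. We may
and shall assume that the monodromy mod `k` of `𝒱` is trivial, for some `k ≥ 3`. … The assumption on the monodromy ensures that the local monodromy of `𝒱`
at infinity is unipotent» — applied in the paper to `𝒱` and (proof of the Theorem on p. 483, «algebraicity of the locus where some `α_s ∈ T^{a,b}`
is Hodge») to its tensor constructions; A. Borel, *Introduction aux groupes arithmétiques*, §17.1, Prop. 17.4.

* §1 TOPOLOGICAL FORM (the covering left abstract): **`exists_finiteIndex_forall_comap_level`** — the level-`3` subgroup `H ≤ π₁(S, s)`: for every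
  `φ : S' → S`, `φ s' = s`, `φ_* π₁(S', s') ≤ H`, the integral monodromy of `φ* D` is `≡ 1 (mod 3)` along EVERY loop at EVERY point of the path
  component of `s'` (the statement the tree's `exists_finiteIndex_forall_comap_isNilpotent_transport_sub_one` proves internally);
  **`exists_finiteIndex_forall_comap_isNilpotent_tensorConstructions_sub_one`** — hence, along every such loop with quasi-unipotent monodromy of
  `φ* D`, the monodromy of `(φ* D)^{⊗m}`, `T^{a,b}(φ* D)`, `(φ* D)^∨`, `(φ* D)(j)` is unipotent; `exists_finiteIndex_forall_comap_isNilpotent_tensor_sub_one`,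
  `…_hom_sub_one` — for two data on the intersection `H₁ ⊓ H₂`.
* §2 SCHEME FORM (granted `riemannExistence_finiteCovering`): **`exists_finiteEtale_forall_isNilpotent_tensorConstructions_sub_one_of_riemannExistence`**
  — for `D` on the complex points of a smooth irreducible quasi-projective `ℂ`-scheme there is a finite étale `g : S' ⟶ S`, `S'(ℂ)` path connected,
  with a point over `s`, such that at every `t' ∈ S'(ℂ)`, along every loop with quasi-unipotent monodromy of `g* D`, the monodromies of
  `(g* D)^{⊗m}`, `T^{a,b}(g* D)`, `(g* D)^∨`, `(g* D)(j)` are unipotent; `exists_finiteEtale_forall_isNilpotent_tensor_sub_one_of_riemannExistence` —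
  one cover for `g* D₁ ⊗ g* D₂` and `Hom(g* D₁, g* D₂)`.

HONEST SCOPE.  Conditional on `FundamentalGroup.riemannExistence_finiteCovering` exactly as the tree's cover theorem; quasi-unipotence along each loop
(the monodromy theorem at infinity) stays a hypothesis; `(g* D)^{⊗m} = g*(D^{⊗m})` etc. on the nose (`Motives/FamiliesVHSComapTensor`) is not needed here.

## References

* [CattaniDeligneKaplan1995] E. Cattani, P. Deligne, A. Kaplan, *On the locus of Hodge classes*, J. Amer. Math. Soc. 8 (1995) 483–506: «Proof of
  1.5 ⟹ 1.1» (p. 485), proof of the Theorem (p. 483–484).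
* [Borel1969] A. Borel, *Introduction aux groupes arithmétiques* (Hermann, 1969), §17.1, Prop. 17.4.
* [SGA1] A. Grothendieck, M. Raynaud, *Revêtements étales et groupe fondamental* (SGA 1), LNM 224, Exp. XII Thm. 5.1 (p. 333).
* [Borel1991] A. Borel, *Linear Algebraic Groups*, 2nd ed., GTM 126 (1991), I.4 (4.2, 4.4).
-/

noncomputable section

open CategoryTheory AlgebraicGeometry

namespace Literature.AlgebraicGeometry.Motives.VHSData

open Literature.AlgebraicGeometry.HodgeTheory

variable {n n₁ n₂ : ℤ}

/-! ## §1 Topological form: the level-`3` subgroup serves all tensor constructions of every dominated pull-back -/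

section Topological

variable {S : Type} [TopologicalSpace S] (D : VHSData S n) (D₁ : VHSData S n₁) (D₂ : VHSData S n₂)

/-- **The level structure of a dominated pull-back, at every point of the path component.**  There is a finite-index subgroup `H ≤ π₁(S, s)` (the
level-`3` subgroup) such that for every continuous `φ : S' → S`, `s'` with `φ s' = s` and `φ_* π₁(S', s') ≤ H`, the integral monodromy of `φ* D` is
`≡ 1 (mod 3)` along every loop at every point joined to `s'`. [cite: CattaniDeligneKaplan1995, «Proof of 1.5 ⟹ 1.1» (p. 485)]
[cite: Borel1969, §17.1] -/
theorem exists_finiteIndex_forall_comap_level (s : S) :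
    ∃ H : Subgroup (FundamentalGroup S s), H.FiniteIndex ∧
      ∀ {S' : Type} [TopologicalSpace S'] (φ : C(S', S)) (s' : S') (hs : φ s' = s),
        (FundamentalGroup.mapOfEq φ hs).range ≤ H →
          ∀ {t' : S'}, Joined s' t' → ∀ (γ' : Path.Homotopic.Quotient t' t') (u : (D.comap φ).VZ.fiber t'),
            ∃ u' : (D.comap φ).VZ.fiber t', (D.comap φ).VZ.transport γ' u - u = (3 : ℕ) • u' := by
  obtain ⟨H, hH, hlevel⟩ := D.exists_finiteIndex_forall_level s (k := 3) (by norm_num)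
  refine ⟨H, hH, ?_⟩
  intro S' _ φ s' hs hφ t' hj γ'
  subst hs
  -- the integral monodromy of `φ* D` is `≡ 1 (mod 3)` at `s'` …
  have hs' : ∀ γ : Path.Homotopic.Quotient s' s', ∀ u : (D.comap φ).VZ.fiber s', ∃ u' : (D.comap φ).VZ.fiber s',
      (D.comap φ).VZ.transport γ u - u = (3 : ℕ) • u' := by
    intro γ u
    obtain ⟨u', hu'⟩ := hlevel _ (hφ ⟨FundamentalGroup.fromPath γ, rfl⟩) u
    refine ⟨u', ?_⟩
    rw [LocalSystem.monodromyRep_apply, FundamentalGroup.mapOfEq_apply, Path.Homotopic.Quotient.cast_rfl_rfl] at hu'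
    exact hu'
  -- … hence at every point of the path component of `s'`
  obtain ⟨δ⟩ := hj
  exact (D.comap φ).VZ.forall_level_of_path (Path.Homotopic.Quotient.mk δ) hs' γ'

/-- **One subgroup for all tensor constructions of every dominated pull-back.**  With `H` the level-`3` subgroup of `D` at `s`: for every
`φ : S' → S` with `φ_* π₁(S', s') ≤ H`, at every point joined to `s'`, along every loop `γ'` with quasi-unipotent monodromy of `φ* D`, the monodromy
along `γ'` of every `(φ* D)^{⊗m}`, every `T^{a,b}(φ* D)`, of `(φ* D)^∨` and of every `(φ* D)(j)` is unipotent. [cite: CattaniDeligneKaplan1995, «Proof of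
1.5 ⟹ 1.1» (p. 485)] [cite: Borel1969, Prop. 17.4] [cite: Borel1991, I.4 (4.2, 4.4)] -/
theorem exists_finiteIndex_forall_comap_isNilpotent_tensorConstructions_sub_one (s : S) :
    ∃ H : Subgroup (FundamentalGroup S s), H.FiniteIndex ∧
      ∀ {S' : Type} [TopologicalSpace S'] (φ : C(S', S)) (s' : S') (hs : φ s' = s),
        (FundamentalGroup.mapOfEq φ hs).range ≤ H →
          ∀ {t' : S'}, Joined s' t' → ∀ (γ' : Path.Homotopic.Quotient t' t') (a : ℕ), 0 < a →
            IsNilpotent ((D.comap φ).V.transport γ' ^ a - 1) →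
              (∀ m : ℕ, IsNilpotent (((D.comap φ).tensorPow m).V.transport γ' - 1)) ∧
                (∀ p q : ℕ, IsNilpotent (((D.comap φ).tensorSpace p q).V.transport γ' - 1)) ∧
                  IsNilpotent ((D.comap φ).dual.V.transport γ' - 1) ∧ ∀ j : ℤ, IsNilpotent (((D.comap φ).tateTwist j).V.transport γ' - 1) := by
  obtain ⟨H, hH, hlevel⟩ := D.exists_finiteIndex_forall_comap_level s
  refine ⟨H, hH, fun φ s' hs hφ t' hj γ' a ha hqu => ?_⟩
  have hl := hlevel φ s' hs hφ hj γ'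
  exact ⟨fun m => (D.comap φ).isNilpotent_tensorPow_V_transport_sub_one_of_level γ' le_rfl hl ha hqu m,
    fun p q => (D.comap φ).isNilpotent_tensorSpace_V_transport_sub_one_of_level γ' le_rfl hl ha hqu p q,
    (D.comap φ).isNilpotent_dual_V_transport_sub_one_of_level γ' le_rfl hl ha hqu,
    fun j => (D.comap φ).isNilpotent_tateTwist_V_transport_sub_one_of_level γ' j le_rfl hl ha hqu⟩

/-- **One subgroup for `φ* D₁ ⊗ φ* D₂`** (the intersection of the two level-`3` subgroups). [cite: CattaniDeligneKaplan1995, «Proof of 1.5 ⟹ 1.1» (p. 485)]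
[cite: Borel1991, I.4 (4.2, 4.4)] -/
theorem exists_finiteIndex_forall_comap_isNilpotent_tensor_sub_one (s : S) :
    ∃ H : Subgroup (FundamentalGroup S s), H.FiniteIndex ∧
      ∀ {S' : Type} [TopologicalSpace S'] (φ : C(S', S)) (s' : S') (hs : φ s' = s),
        (FundamentalGroup.mapOfEq φ hs).range ≤ H →
          ∀ {t' : S'}, Joined s' t' → ∀ (γ' : Path.Homotopic.Quotient t' t') (a₁ : ℕ), 0 < a₁ →
            IsNilpotent ((D₁.comap φ).V.transport γ' ^ a₁ - 1) → ∀ a₂ : ℕ, 0 < a₂ → IsNilpotent ((D₂.comap φ).V.transport γ' ^ a₂ - 1) →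
              IsNilpotent (((D₁.comap φ).tensor (D₂.comap φ)).V.transport γ' - 1) := by
  obtain ⟨H₁, hH₁, hlevel₁⟩ := D₁.exists_finiteIndex_forall_comap_level s
  obtain ⟨H₂, hH₂, hlevel₂⟩ := D₂.exists_finiteIndex_forall_comap_level s
  haveI := hH₁
  haveI := hH₂
  refine ⟨H₁ ⊓ H₂, inferInstance, fun φ s' hs hφ t' hj γ' a₁ ha₁ hqu₁ a₂ ha₂ hqu₂ => ?_⟩
  exact (D₁.comap φ).isNilpotent_tensor_V_transport_sub_one (D₂.comap φ) γ'
    ((D₁.comap φ).isNilpotent_transport_sub_one_of_level γ' le_rfl (hlevel₁ φ s' hs (hφ.trans inf_le_left) hj γ') ha₁ hqu₁)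
    ((D₂.comap φ).isNilpotent_transport_sub_one_of_level γ' le_rfl (hlevel₂ φ s' hs (hφ.trans inf_le_right) hj γ') ha₂ hqu₂)

/-- **One subgroup for `Hom(φ* D₁, φ* D₂)`** (same weight). [cite: CattaniDeligneKaplan1995, «Proof of 1.5 ⟹ 1.1» (p. 485)] [cite: Borel1991, I.4 (4.2, 4.4)] -/
theorem exists_finiteIndex_forall_comap_isNilpotent_hom_sub_one (D₁ D₂ : VHSData S n) (s : S) :
    ∃ H : Subgroup (FundamentalGroup S s), H.FiniteIndex ∧
      ∀ {S' : Type} [TopologicalSpace S'] (φ : C(S', S)) (s' : S') (hs : φ s' = s),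
        (FundamentalGroup.mapOfEq φ hs).range ≤ H →
          ∀ {t' : S'}, Joined s' t' → ∀ (γ' : Path.Homotopic.Quotient t' t') (a₁ : ℕ), 0 < a₁ →
            IsNilpotent ((D₁.comap φ).V.transport γ' ^ a₁ - 1) → ∀ a₂ : ℕ, 0 < a₂ → IsNilpotent ((D₂.comap φ).V.transport γ' ^ a₂ - 1) →
              IsNilpotent (((D₁.comap φ).hom (D₂.comap φ)).V.transport γ' - 1) := by
  obtain ⟨H₁, hH₁, hlevel₁⟩ := D₁.exists_finiteIndex_forall_comap_level s
  obtain ⟨H₂, hH₂, hlevel₂⟩ := D₂.exists_finiteIndex_forall_comap_level s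
  haveI := hH₁
  haveI := hH₂
  refine ⟨H₁ ⊓ H₂, inferInstance, fun φ s' hs hφ t' hj γ' a₁ ha₁ hqu₁ a₂ ha₂ hqu₂ => ?_⟩
  exact (D₁.comap φ).isNilpotent_hom_V_transport_sub_one (D₂.comap φ) γ'
    ((D₁.comap φ).isNilpotent_transport_sub_one_of_level γ' le_rfl (hlevel₁ φ s' hs (hφ.trans inf_le_left) hj γ') ha₁ hqu₁)
    ((D₂.comap φ).isNilpotent_transport_sub_one_of_level γ' le_rfl (hlevel₂ φ s' hs (hφ.trans inf_le_right) hj γ') ha₂ hqu₂)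

end Topological

/-! ## §2 Scheme form: the finite étale cover, granted Riemann's existence theorem -/

section Scheme

/-- From a finite-index subgroup `H` of `π₁` of the subspace `univ ⊆ S(ℂ)` to the finite étale cover it dominates, together with the definitional bridge
from the level structure of the double pull-back `(E|_{univ})* φ'` along the loops of `univ ⊆ S'(ℂ)` to that of `g* E` along the loops of `S'(ℂ)` (the
common skeleton of the proofs below, as in the tree's `exists_finiteEtale_forall_isNilpotent_transport_sub_one_of_riemannExistence`).
[cite: SGA1, Exp. XII Thm. 5.1 (p. 333)] -/
private theorem exists_finiteEtale_range_le_of_riemannExistence (hRE : FundamentalGroup.riemannExistence_finiteCovering) (S : SchemeOver ℂ)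
    (hS : IsQuasiProjectiveOver S) [IrreducibleSpace S.left] (d : ℕ) [SmoothOfRelativeDimension d S.hom] (s : ComplexPoints S)
    (H : Subgroup (FundamentalGroup (Set.univ : Set (ComplexPoints S)) ⟨s, Set.mem_univ s⟩)) [H.FiniteIndex] :
    ∃ (S' : SchemeOver ℂ) (g : S' ⟶ S), IsFinite g.left ∧ Etale g.left ∧ PathConnectedSpace (ComplexPoints S') ∧
      (∃ s' : ComplexPoints S', AlgPoints.map g s' = s) ∧
      ∃ (φ' : C((Set.univ : Set (ComplexPoints S')), (Set.univ : Set (ComplexPoints S)))) (s' : ComplexPoints S')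
        (hs' : φ' ⟨s', Set.mem_univ s'⟩ = ⟨s, Set.mem_univ s⟩),
        (FundamentalGroup.mapOfEq φ' hs').range ≤ H ∧
          (∀ t' : ComplexPoints S', Joined (⟨s', Set.mem_univ s'⟩ : (Set.univ : Set (ComplexPoints S'))) ⟨t', Set.mem_univ t'⟩) ∧
            ∀ {m : ℤ} (E : VHSData (ComplexPoints S) m) {t' : ComplexPoints S'} (p : Path t' t'),
              (∀ (γ : Path.Homotopic.Quotient (⟨t', Set.mem_univ t'⟩ : (Set.univ : Set (ComplexPoints S'))) ⟨t', Set.mem_univ t'⟩)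
                  (u : ((E.comap ⟨Subtype.val, continuous_subtype_val⟩).comap φ').VZ.fiber ⟨t', Set.mem_univ t'⟩),
                  ∃ u' : ((E.comap ⟨Subtype.val, continuous_subtype_val⟩).comap φ').VZ.fiber ⟨t', Set.mem_univ t'⟩,
                    ((E.comap ⟨Subtype.val, continuous_subtype_val⟩).comap φ').VZ.transport γ u - u = (3 : ℕ) • u') →
                ∀ u : (E.comap (AlgPoints.mapContinuous g)).VZ.fiber t', ∃ u' : (E.comap (AlgPoints.mapContinuous g)).VZ.fiber t',
                  (E.comap (AlgPoints.mapContinuous g)).VZ.transport (Path.Homotopic.Quotient.mk p) u - u = (3 : ℕ) • u' := by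
  obtain ⟨S', g, s', hs, hfin, het, hpc, hloop⟩ := exists_finiteEtale_of_finiteIndex_of_riemannExistence hRE S hS d s H
  refine ⟨S', g, hfin, het, hpc, ⟨s', hs⟩, ?_⟩
  haveI := hpc
  haveI : PathConnectedSpace (Set.univ : Set (ComplexPoints S')) := isPathConnected_iff_pathConnectedSpace.mp isPathConnected_univ
  -- the induced map of the subspaces `univ` and the domination `g(ℂ)_* π₁(S'(ℂ), s') ≤ H`
  let φ' : C((Set.univ : Set (ComplexPoints S')), (Set.univ : Set (ComplexPoints S))) :=
    ⟨fun x => ⟨AlgPoints.map g x.1, Set.mem_univ _⟩,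
      ((AlgPoints.continuous_map g).comp continuous_subtype_val).subtype_mk fun _ => Set.mem_univ _⟩
  have hs' : φ' ⟨s', Set.mem_univ s'⟩ = ⟨s, Set.mem_univ s⟩ := Subtype.ext hs
  refine ⟨φ', s', hs', ?_, fun t' => PathConnectedSpace.joined _ _, ?_⟩
  · rintro _ ⟨γ'', rfl⟩
    induction γ'' using Path.Homotopic.Quotient.ind with
    | mk q =>
      rw [FundamentalGroup.mapOfEq_apply]
      exact hloop q
  · -- from loops of the subspace `univ ⊆ S'(ℂ)` to loops of `S'(ℂ)`
    intro m E t' p key u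
    have hk : Continuous fun x : ComplexPoints S' => (⟨x, Set.mem_univ x⟩ : (Set.univ : Set (ComplexPoints S'))) :=
      continuous_id.subtype_mk _
    have e : ((E.comap ⟨Subtype.val, continuous_subtype_val⟩).comap φ').VZ.transport (Path.Homotopic.Quotient.mk (p.map hk)) =
        (E.comap (AlgPoints.mapContinuous g)).VZ.transport (Path.Homotopic.Quotient.mk p) := rfl
    obtain ⟨u', hu'⟩ := key (Path.Homotopic.Quotient.mk (p.map hk)) u
    refine ⟨u', ?_⟩
    rw [e] at hu'
    exact hu'

/-- **Cattani–Deligne–Kaplan, «Proof of 1.5 ⟹ 1.1», the finite étale cover — for all the tensor constructions at once.**  Let `S` be a smooth irreducible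
quasi-projective `ℂ`-scheme, `D` the data of a polarized `ℤ`VHS on `S(ℂ)`, `s ∈ S(ℂ)`.  Granted `FundamentalGroup.riemannExistence_finiteCovering` there
are a FINITE ÉTALE `g : S' ⟶ S` with `S'(ℂ)` path connected and a point of `S'(ℂ)` over `s` such that for `g(ℂ)* D`: at every `t' ∈ S'(ℂ)`, along every
loop `γ'` at `t'` whose monodromy on `V` is quasi-unipotent, the monodromy along `γ'` of EVERY `(g* D)^{⊗m}`, every `T^{a,b}(g* D)`, of `(g* D)^∨` and of
every `(g* D)(j)` is unipotent. [cite: CattaniDeligneKaplan1995, «Proof of 1.5 ⟹ 1.1» (p. 485)] [cite: SGA1, Exp. XII Thm. 5.1 (p. 333)]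
[cite: Borel1969, §17.1 and Prop. 17.4] [cite: Borel1991, I.4 (4.2, 4.4)] -/
theorem exists_finiteEtale_forall_isNilpotent_tensorConstructions_sub_one_of_riemannExistence
    (hRE : FundamentalGroup.riemannExistence_finiteCovering) (S : SchemeOver ℂ) (hS : IsQuasiProjectiveOver S) [IrreducibleSpace S.left]
    (d : ℕ) [SmoothOfRelativeDimension d S.hom] (D : VHSData (ComplexPoints S) n) (s : ComplexPoints S) :
    ∃ (S' : SchemeOver ℂ) (g : S' ⟶ S), IsFinite g.left ∧ Etale g.left ∧ PathConnectedSpace (ComplexPoints S') ∧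
      (∃ s' : ComplexPoints S', AlgPoints.map g s' = s) ∧
      ∀ (t' : ComplexPoints S') (γ' : Path.Homotopic.Quotient t' t') (a : ℕ), 0 < a →
        IsNilpotent ((D.comap (AlgPoints.mapContinuous g)).V.transport γ' ^ a - 1) →
          (∀ m : ℕ, IsNilpotent (((D.comap (AlgPoints.mapContinuous g)).tensorPow m).V.transport γ' - 1)) ∧
            (∀ p q : ℕ, IsNilpotent (((D.comap (AlgPoints.mapContinuous g)).tensorSpace p q).V.transport γ' - 1)) ∧
              IsNilpotent ((D.comap (AlgPoints.mapContinuous g)).dual.V.transport γ' - 1) ∧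
                ∀ j : ℤ, IsNilpotent (((D.comap (AlgPoints.mapContinuous g)).tateTwist j).V.transport γ' - 1) := by
  -- the datum on the subspace `univ ⊆ S(ℂ)` and its level-`3` subgroup at `s`
  let valS : C((Set.univ : Set (ComplexPoints S)), ComplexPoints S) := ⟨Subtype.val, continuous_subtype_val⟩
  obtain ⟨H, hH, hlevel⟩ := (D.comap valS).exists_finiteIndex_forall_comap_level ⟨s, Set.mem_univ s⟩
  haveI := hH
  obtain ⟨S', g, hfin, het, hpc, hs, φ', s', hs', hrange, hjoined, hbridge⟩ := exists_finiteEtale_range_le_of_riemannExistence hRE S hS d s H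
  refine ⟨S', g, hfin, het, hpc, hs, ?_⟩
  intro t' γ'
  have key := hlevel φ' ⟨s', Set.mem_univ s'⟩ hs' hrange (hjoined t')
  -- from loops of the subspace `univ ⊆ S'(ℂ)` to loops of `S'(ℂ)`: the level structure of `g* D` along `γ'`
  induction γ' using Path.Homotopic.Quotient.ind with
  | mk p =>
    intro a ha hqu
    have hl := hbridge D p key
    exact ⟨fun m => (D.comap _).isNilpotent_tensorPow_V_transport_sub_one_of_level _ le_rfl hl ha hqu m,
      fun p' q => (D.comap _).isNilpotent_tensorSpace_V_transport_sub_one_of_level _ le_rfl hl ha hqu p' q,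
      (D.comap _).isNilpotent_dual_V_transport_sub_one_of_level _ le_rfl hl ha hqu,
      fun j => (D.comap _).isNilpotent_tateTwist_V_transport_sub_one_of_level _ j le_rfl hl ha hqu⟩

/-- **One finite étale cover for `g* D₁ ⊗ g* D₂` and `Hom(g* D₁, g* D₂)`** (the cover attached to the intersection of the two level-`3` subgroups):
along every loop of `S'(ℂ)` with quasi-unipotent monodromies of `g* D₁` and `g* D₂`, the monodromies of `g* D₁ ⊗ g* D₂` and — for equal weights — of
`Hom(g* D₁, g* D₂)` are unipotent. [cite: CattaniDeligneKaplan1995, «Proof of 1.5 ⟹ 1.1» (p. 485)] [cite: SGA1, Exp. XII Thm. 5.1 (p. 333)]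
[cite: Borel1991, I.4 (4.2, 4.4)] -/
theorem exists_finiteEtale_forall_isNilpotent_tensor_sub_one_of_riemannExistence
    (hRE : FundamentalGroup.riemannExistence_finiteCovering) (S : SchemeOver ℂ) (hS : IsQuasiProjectiveOver S) [IrreducibleSpace S.left]
    (d : ℕ) [SmoothOfRelativeDimension d S.hom] (D₁ : VHSData (ComplexPoints S) n₁) (D₂ : VHSData (ComplexPoints S) n₂)
    (D₃ : VHSData (ComplexPoints S) n₁) (s : ComplexPoints S) :
    ∃ (S' : SchemeOver ℂ) (g : S' ⟶ S), IsFinite g.left ∧ Etale g.left ∧ PathConnectedSpace (ComplexPoints S') ∧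
      (∃ s' : ComplexPoints S', AlgPoints.map g s' = s) ∧
      ∀ (t' : ComplexPoints S') (γ' : Path.Homotopic.Quotient t' t') (a₁ : ℕ), 0 < a₁ →
        IsNilpotent ((D₁.comap (AlgPoints.mapContinuous g)).V.transport γ' ^ a₁ - 1) →
          (∀ a₂ : ℕ, 0 < a₂ → IsNilpotent ((D₂.comap (AlgPoints.mapContinuous g)).V.transport γ' ^ a₂ - 1) →
            IsNilpotent (((D₁.comap (AlgPoints.mapContinuous g)).tensor (D₂.comap (AlgPoints.mapContinuous g))).V.transport γ' - 1)) ∧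
          (∀ a₃ : ℕ, 0 < a₃ → IsNilpotent ((D₃.comap (AlgPoints.mapContinuous g)).V.transport γ' ^ a₃ - 1) →
            IsNilpotent (((D₁.comap (AlgPoints.mapContinuous g)).hom (D₃.comap (AlgPoints.mapContinuous g))).V.transport γ' - 1)) := by
  let valS : C((Set.univ : Set (ComplexPoints S)), ComplexPoints S) := ⟨Subtype.val, continuous_subtype_val⟩
  obtain ⟨H₁, hH₁, hlevel₁⟩ := (D₁.comap valS).exists_finiteIndex_forall_comap_level ⟨s, Set.mem_univ s⟩
  obtain ⟨H₂, hH₂, hlevel₂⟩ := (D₂.comap valS).exists_finiteIndex_forall_comap_level ⟨s, Set.mem_univ s⟩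
  obtain ⟨H₃, hH₃, hlevel₃⟩ := (D₃.comap valS).exists_finiteIndex_forall_comap_level ⟨s, Set.mem_univ s⟩
  haveI := hH₁
  haveI := hH₂
  haveI := hH₃
  obtain ⟨S', g, hfin, het, hpc, hs, φ', s', hs', hrange, hjoined, hbridge⟩ :=
    exists_finiteEtale_range_le_of_riemannExistence hRE S hS d s ((H₁ ⊓ H₂) ⊓ H₃)
  refine ⟨S', g, hfin, het, hpc, hs, ?_⟩
  intro t' γ'
  have key₁ := hlevel₁ φ' ⟨s', Set.mem_univ s'⟩ hs' ((hrange.trans inf_le_left).trans inf_le_left) (hjoined t')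
  have key₂ := hlevel₂ φ' ⟨s', Set.mem_univ s'⟩ hs' ((hrange.trans inf_le_left).trans inf_le_right) (hjoined t')
  have key₃ := hlevel₃ φ' ⟨s', Set.mem_univ s'⟩ hs' (hrange.trans inf_le_right) (hjoined t')
  induction γ' using Path.Homotopic.Quotient.ind with
  | mk p =>
    intro a₁ ha₁ hqu₁
    have hu₁ := (D₁.comap (AlgPoints.mapContinuous g)).isNilpotent_transport_sub_one_of_level _ le_rfl
      (hbridge D₁ p key₁) ha₁ hqu₁
    exact ⟨fun a₂ ha₂ hqu₂ => (D₁.comap _).isNilpotent_tensor_V_transport_sub_one (D₂.comap _) _ hu₁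
        ((D₂.comap (AlgPoints.mapContinuous g)).isNilpotent_transport_sub_one_of_level _ le_rfl
          (hbridge D₂ p key₂) ha₂ hqu₂),
      fun a₃ ha₃ hqu₃ => (D₁.comap _).isNilpotent_hom_V_transport_sub_one (D₃.comap _) _ hu₁
        ((D₃.comap (AlgPoints.mapContinuous g)).isNilpotent_transport_sub_one_of_level _ le_rfl
          (hbridge D₃ p key₃) ha₃ hqu₃)⟩

end Scheme

end Literature.AlgebraicGeometry.Motives.VHSData

end
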